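import Literature.Algebra.Homology.OrderedCech
import Mathlib.Data.Prod.Lex
import HarnessLib

/-!
# The shuffle coefficients of the Eilenberg–Zilber map on a product cover, by recursion on the last vertex
# (Eilenberg–Mac Lane 1953 §5; The Stacks Project, Tag 0BEC)

Layer `Literature/Algebra/Homology` (one `def` by well-founded recursion + proved lemmas; 0 named facts, no instance, no notation;
pure finite combinatorics).  For finite subsets `s ⊆ ι`, `t ⊆ κ` of two linear orders, the LATTICE PATHS from `(min s, min t)` to
`(max s, max t)` inside `s × t` (unit steps, both coordinates non-decreasing) are exactly the chains `T ⊆ ι ×ₗ κ` (LEXICOGRAPHIC order)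
along which the Eilenberg–Zilber / shuffle map `∇` of the Künneth comparison evaluates a Čech cochain of the PRODUCT COVER
(`Algebra/Homology/OrderedCechLexSystem`): `(∇c)_{s,t} = Σ_T sgn(T) · c_T`, `sgn(T) = (-1)^{#cells of s × t below T}` (the sign of the
`(a,b)`-shuffle, `#s = a+1`, `#t = b+1`).  Instead of enumerating paths we define the COEFFICIENT FUNCTION

* **`shuffleCoeff s t T : ℤ`** by recursion on `#s + #t` through the LAST VERTEX `w₁ = (max s, max t)` (which every path contains, preceded by
  a horizontal or a vertical step): `m(s,t,T) = [T = {w₁}]` if `#s = #t = 1`, and otherwise, for `w₁ ∈ T`,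
  `m(s,t,T) = (-1)^{#t-1} · m(s ∖ max s, t, T ∖ w₁) + m(s, t ∖ max t, T ∖ w₁)` (a path ending with a horizontal step sweeps `#t − 1` new
  cells; one ending with a vertical step none), `0` if `w₁ ∉ T` or `s = ∅` or `t = ∅`;
* its SUPPORT (`shuffleCoeff_ne_zero_imp` and corollaries): `m(s,t,T) ≠ 0` forces `s`, `t` non-empty, `T ⊆ s × t`, the last vertex in `T`,
  `#T + 1 = #s + #t` (a path with `#s − 1` horizontal and `#t − 1` vertical steps), all of `T` below the last vertex;
* the helpers of the cochain-map identity (sequels `…ShuffleCoefficientRecursion`, `…ShuffleCoefficientIdentity`): the uniform one-step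
  unfolding `shuffleCoeff_unfold` (with the `1 × 1` indicator), vanishing when a vertex sits in an erased column/row, the Čech face-sign
  lemmas `sign_max'` (`ε(s, max s) = (-1)^{#s-1}`), `sign_erase_of_not_lt`, `sign_insert_of_not_lt`, `sign_insert_self_of_forall_lt`, and the
  one-vertex level `sum_shuffleCoeff_singleton` (`Σ_w m(s,t,{w}) ε({w},w) = [#s = #t = 1]`).

Cell `hodgecm-mathlib` (D-0151), F-11 / J3 Künneth packet, brick (K2-c-1) of F0P1b-p04's plan (planner RULINGS #3 (R15)); consumer (K2-c-2)
`Algebra/Homology/OrderedCechPairSystemShuffle` (the map `∇` and `∇ ∘ cross = 𝟙`).  HC_CM is proved only modulo the 7 printed citations until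
rung 0 closes — nothing here bears on a summit statement.

## References
* S. Eilenberg, S. Mac Lane, *On the groups `H(Π,n)`, I*, Ann. of Math. 58 (1953), §5 (the shuffle map `∇`, Thm. 5.2). [EilenbergMacLane1953]
* The Stacks Project, Tag 0BEC (Künneth formula via the double Čech complex), Tag 01FG. [StacksProject]
* U. Görtz, T. Wedhorn, *Algebraic Geometry II* (2023), Def. 21.68 (p. 180) (the Čech face signs). [GortzWedhorn2023]
-/

open Finset

namespace Literature.Algebra.Homology

namespace OrderedCech

variable {ι κ : Type} [LinearOrder ι] [LinearOrder κ]

/-! ### §1 The coefficient function -/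

/-- **The shuffle coefficient `m(s, t, T) ∈ ℤ`** of a finite `T ⊆ ι ×ₗ κ` relative to the rectangle `s × t`: the signed indicator of
«`T` is a lattice path from `(min s, min t)` to `(max s, max t)` in `s × t`», sign `(-1)^{#cells below the path}`, defined by recursion on
`#s + #t` through the last vertex `(max s, max t)`. [cite: EilenbergMacLane1953, §5] [cite: StacksProject, Tag 0BEC] -/
def shuffleCoeff (s : Finset ι) (t : Finset κ) (T : Finset (ι ×ₗ κ)) : ℤ :=
  if hs : s.Nonempty then
    if ht : t.Nonempty then
      if s.card = 1 ∧ t.card = 1 then (if T = {toLex (s.max' hs, t.max' ht)} then 1 else 0)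
      else if toLex (s.max' hs, t.max' ht) ∈ T then
        (-1) ^ (t.card - 1) * shuffleCoeff (s.erase (s.max' hs)) t (T.erase (toLex (s.max' hs, t.max' ht)))
          + shuffleCoeff s (t.erase (t.max' ht)) (T.erase (toLex (s.max' hs, t.max' ht)))
      else 0
    else 0
  else 0
termination_by s.card + t.card
decreasing_by
  · have := Finset.card_erase_lt_of_mem (s.max'_mem hs); omega
  · have := Finset.card_erase_lt_of_mem (t.max'_mem ht); omega

/-- `m(∅, t, T) = 0`. [cite: EilenbergMacLane1953, §5] -/
theorem shuffleCoeff_of_not_nonempty_left {s : Finset ι} (hs : ¬ s.Nonempty) (t : Finset κ) (T : Finset (ι ×ₗ κ)) :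
    shuffleCoeff s t T = 0 := by
  rw [shuffleCoeff, dif_neg hs]

/-- `m(s, ∅, T) = 0`. [cite: EilenbergMacLane1953, §5] -/
theorem shuffleCoeff_of_not_nonempty_right (s : Finset ι) {t : Finset κ} (ht : ¬ t.Nonempty) (T : Finset (ι ×ₗ κ)) :
    shuffleCoeff s t T = 0 := by
  rw [shuffleCoeff]
  by_cases hs : s.Nonempty
  · rw [dif_pos hs, dif_neg ht]
  · rw [dif_neg hs]

/-- The `1 × 1` rectangle: `m({i}, {j}, T) = [T = {(i,j)}]`. [cite: EilenbergMacLane1953, §5] -/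
theorem shuffleCoeff_of_card_eq_one {s : Finset ι} {t : Finset κ} (hs : s.Nonempty) (ht : t.Nonempty)
    (h1 : s.card = 1 ∧ t.card = 1) (T : Finset (ι ×ₗ κ)) :
    shuffleCoeff s t T = if T = {toLex (s.max' hs, t.max' ht)} then 1 else 0 := by
  rw [shuffleCoeff, dif_pos hs, dif_pos ht, if_pos h1]

/-- **The last-vertex recursion**: outside the `1 × 1` case, `m(s,t,T) = 0` unless `w₁ = (max s, max t) ∈ T`, and then
`m(s,t,T) = (-1)^{#t-1} m(s ∖ max s, t, T ∖ w₁) + m(s, t ∖ max t, T ∖ w₁)` (last step horizontal / vertical).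
[cite: EilenbergMacLane1953, §5] -/
theorem shuffleCoeff_of_not_card_eq_one {s : Finset ι} {t : Finset κ} (hs : s.Nonempty) (ht : t.Nonempty)
    (h1 : ¬ (s.card = 1 ∧ t.card = 1)) (T : Finset (ι ×ₗ κ)) :
    shuffleCoeff s t T =
      if toLex (s.max' hs, t.max' ht) ∈ T then
        (-1) ^ (t.card - 1) * shuffleCoeff (s.erase (s.max' hs)) t (T.erase (toLex (s.max' hs, t.max' ht)))
          + shuffleCoeff s (t.erase (t.max' ht)) (T.erase (toLex (s.max' hs, t.max' ht)))
      else 0 := by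
  rw [shuffleCoeff, dif_pos hs, dif_pos ht, if_neg h1]

/-! ### §2 Support of the coefficient function -/

/-- **Support of the shuffle coefficient.**  If `m(s,t,T) ≠ 0` then `s`, `t` are non-empty, `T ⊆ s × t`, the last vertex
`(max s, max t)` lies in `T`, and `#T + 1 = #s + #t` (a lattice path with `#s − 1` horizontal and `#t − 1` vertical steps).
[cite: EilenbergMacLane1953, §5] [cite: StacksProject, Tag 0BEC] -/
theorem shuffleCoeff_ne_zero_imp {s : Finset ι} {t : Finset κ} {T : Finset (ι ×ₗ κ)} (h : shuffleCoeff s t T ≠ 0) :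
    ∃ (hs : s.Nonempty) (ht : t.Nonempty), (∀ w ∈ T, (ofLex w).1 ∈ s ∧ (ofLex w).2 ∈ t) ∧
      toLex (s.max' hs, t.max' ht) ∈ T ∧ T.card + 1 = s.card + t.card := by
  induction hn : s.card + t.card using Nat.strong_induction_on generalizing s t T with
  | _ n ih =>
    by_cases hs : s.Nonempty
    swap
    · exact absurd (shuffleCoeff_of_not_nonempty_left hs t T) h
    by_cases ht : t.Nonempty
    swap
    · exact absurd (shuffleCoeff_of_not_nonempty_right s ht T) h
    refine ⟨hs, ht, ?_⟩
    by_cases h1 : s.card = 1 ∧ t.card = 1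
    · rw [shuffleCoeff_of_card_eq_one hs ht h1] at h
      have hT : T = {toLex (s.max' hs, t.max' ht)} := by
        by_contra hT; rw [if_neg hT] at h; exact h rfl
      subst hT
      refine ⟨fun w hw => ?_, Finset.mem_singleton_self _, by rw [Finset.card_singleton]; omega⟩
      rw [Finset.mem_singleton] at hw
      subst hw
      exact ⟨s.max'_mem hs, t.max'_mem ht⟩
    · rw [shuffleCoeff_of_not_card_eq_one hs ht h1] at h
      by_cases hw : toLex (s.max' hs, t.max' ht) ∈ T
      swap
      · rw [if_neg hw] at h; exact absurd rfl h
      rw [if_pos hw] at h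
      set w₁ : ι ×ₗ κ := toLex (s.max' hs, t.max' ht) with hw₁
      have hcard : (T.erase w₁).card + 1 = T.card := Finset.card_erase_add_one hw
      -- one of the two summands is non-zero
      have hor : shuffleCoeff (s.erase (s.max' hs)) t (T.erase w₁) ≠ 0 ∨ shuffleCoeff s (t.erase (t.max' ht)) (T.erase w₁) ≠ 0 := by
        by_cases hA : shuffleCoeff (s.erase (s.max' hs)) t (T.erase w₁) = 0
        · refine Or.inr fun hB => ?_
          rw [hA, hB, mul_zero, add_zero] at h
          exact h rfl
        · exact Or.inl hA
      have hsub : ∀ w ∈ T, w ≠ w₁ → w ∈ T.erase w₁ := fun w hw' hne => Finset.mem_erase.mpr ⟨hne, hw'⟩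
      rcases hor with h' | h'
      · -- last step horizontal: `T ∖ w₁` is a path in `(s ∖ max s) × t`
        have hlt : (s.erase (s.max' hs)).card + t.card < n := by
          have := Finset.card_erase_lt_of_mem (s.max'_mem hs); omega
        obtain ⟨hs', -, hmem, -, hc'⟩ := ih _ hlt h' rfl
        refine ⟨fun w hwT => ?_, hw, ?_⟩
        · by_cases hne : w = w₁
          · subst hne; exact ⟨s.max'_mem hs, t.max'_mem ht⟩
          · obtain ⟨h1', h2'⟩ := hmem w (hsub w hwT hne)
            exact ⟨Finset.mem_of_mem_erase h1', h2'⟩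
        · have := Finset.card_erase_add_one (s.max'_mem hs); omega
      · -- last step vertical: `T ∖ w₁` is a path in `s × (t ∖ max t)`
        have hlt : s.card + (t.erase (t.max' ht)).card < n := by
          have := Finset.card_erase_lt_of_mem (t.max'_mem ht); omega
        obtain ⟨-, ht', hmem, -, hc'⟩ := ih _ hlt h' rfl
        refine ⟨fun w hwT => ?_, hw, ?_⟩
        · by_cases hne : w = w₁
          · subst hne; exact ⟨s.max'_mem hs, t.max'_mem ht⟩
          · obtain ⟨h1', h2'⟩ := hmem w (hsub w hwT hne)
            exact ⟨h1', Finset.mem_of_mem_erase h2'⟩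
        · have := Finset.card_erase_add_one (t.max'_mem ht); omega

/-- If `m(s,t,T) ≠ 0` every `w ∈ T` lies in `s × t`. [cite: EilenbergMacLane1953, §5] -/
theorem mem_of_shuffleCoeff_ne_zero {s : Finset ι} {t : Finset κ} {T : Finset (ι ×ₗ κ)} (h : shuffleCoeff s t T ≠ 0)
    {w : ι ×ₗ κ} (hw : w ∈ T) : (ofLex w).1 ∈ s ∧ (ofLex w).2 ∈ t := by
  obtain ⟨_, _, hmem, -, -⟩ := shuffleCoeff_ne_zero_imp h
  exact hmem w hw

/-- If `m(s,t,T) ≠ 0` then `#T + 1 = #s + #t`. [cite: EilenbergMacLane1953, §5] -/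
theorem card_of_shuffleCoeff_ne_zero {s : Finset ι} {t : Finset κ} {T : Finset (ι ×ₗ κ)} (h : shuffleCoeff s t T ≠ 0) :
    T.card + 1 = s.card + t.card := by
  obtain ⟨_, _, -, -, hc⟩ := shuffleCoeff_ne_zero_imp h
  exact hc

/-- If `m(s,t,T) ≠ 0` then the last vertex `(max s, max t)` lies in `T`. [cite: EilenbergMacLane1953, §5] -/
theorem max_mem_of_shuffleCoeff_ne_zero {s : Finset ι} {t : Finset κ} {T : Finset (ι ×ₗ κ)} (h : shuffleCoeff s t T ≠ 0)
    (hs : s.Nonempty) (ht : t.Nonempty) : toLex (s.max' hs, t.max' ht) ∈ T := by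
  obtain ⟨_, _, -, hw, -⟩ := shuffleCoeff_ne_zero_imp h
  exact hw

/-- If `m(s,t,T) ≠ 0` every `w ∈ T` is `≤` the last vertex in the lexicographic order. [cite: EilenbergMacLane1953, §5] -/
theorem le_max_of_shuffleCoeff_ne_zero {s : Finset ι} {t : Finset κ} {T : Finset (ι ×ₗ κ)} (h : shuffleCoeff s t T ≠ 0)
    (hs : s.Nonempty) (ht : t.Nonempty) {w : ι ×ₗ κ} (hw : w ∈ T) : w ≤ toLex (s.max' hs, t.max' ht) := by
  obtain ⟨h1, h2⟩ := mem_of_shuffleCoeff_ne_zero h hw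
  rcases (s.le_max' _ h1).lt_or_eq with hlt | heq
  · exact le_of_lt (Prod.Lex.lt_iff.mpr (Or.inl hlt))
  · exact Prod.Lex.le_iff.mpr (Or.inr ⟨heq, t.le_max' _ h2⟩)

/-! ### §3 Helpers for the cochain-map identity -/

omit [LinearOrder ι] [LinearOrder κ] in
/-- `w ∈ s × t` read in `ι ×ₗ κ`. [cite: StacksProject, Tag 0BEC] -/
theorem mem_image_toLex [DecidableEq ι] [DecidableEq κ] {s : Finset ι} {t : Finset κ} {w : ι ×ₗ κ} :
    w ∈ (s ×ˢ t).image toLex ↔ (ofLex w).1 ∈ s ∧ (ofLex w).2 ∈ t := by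
  constructor
  · rintro h
    obtain ⟨x, hx, rfl⟩ := Finset.mem_image.mp h
    exact Finset.mem_product.mp hx
  · rintro ⟨h1, h2⟩
    exact Finset.mem_image.mpr ⟨ofLex w, Finset.mem_product.mpr ⟨h1, h2⟩, rfl⟩

/-- **One-step unfolding at a set containing the last vertex**, uniform in the `1 × 1` case: for `w₁ = (max s, max t) ∈ T`,
`m(s,t,T) = (-1)^{#t-1} m(s ∖ max s, t, T ∖ w₁) + m(s, t ∖ max t, T ∖ w₁) + [#s = 1 ∧ #t = 1 ∧ T = {w₁}]`.
[cite: EilenbergMacLane1953, §5] -/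
theorem shuffleCoeff_unfold {s : Finset ι} {t : Finset κ} (hs : s.Nonempty) (ht : t.Nonempty) {T : Finset (ι ×ₗ κ)}
    (hw : toLex (s.max' hs, t.max' ht) ∈ T) :
    shuffleCoeff s t T =
      (-1) ^ (t.card - 1) * shuffleCoeff (s.erase (s.max' hs)) t (T.erase (toLex (s.max' hs, t.max' ht)))
        + shuffleCoeff s (t.erase (t.max' ht)) (T.erase (toLex (s.max' hs, t.max' ht)))
        + (if s.card = 1 ∧ t.card = 1 ∧ T = {toLex (s.max' hs, t.max' ht)} then 1 else 0) := by
  by_cases h1 : s.card = 1 ∧ t.card = 1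
  · rw [shuffleCoeff_of_card_eq_one hs ht h1]
    have hs' : ¬ (s.erase (s.max' hs)).Nonempty := by
      rw [Finset.not_nonempty_iff_eq_empty, ← Finset.card_eq_zero]
      have := Finset.card_erase_add_one (s.max'_mem hs); omega
    have ht' : ¬ (t.erase (t.max' ht)).Nonempty := by
      rw [Finset.not_nonempty_iff_eq_empty, ← Finset.card_eq_zero]
      have := Finset.card_erase_add_one (t.max'_mem ht); omega
    rw [shuffleCoeff_of_not_nonempty_left hs', shuffleCoeff_of_not_nonempty_right _ ht', mul_zero, zero_add, zero_add]
    by_cases hT : T = {toLex (s.max' hs, t.max' ht)}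
    · rw [if_pos hT, if_pos ⟨h1.1, h1.2, hT⟩]
    · rw [if_neg hT, if_neg (fun h => hT h.2.2)]
  · rw [shuffleCoeff_of_not_card_eq_one hs ht h1, if_pos hw, if_neg (fun h => h1 ⟨h.1, h.2.1⟩), add_zero]

/-- `m(s,t,T) = 0` if the last vertex is missing from `T`. [cite: EilenbergMacLane1953, §5] -/
theorem shuffleCoeff_eq_zero_of_max_not_mem {s : Finset ι} {t : Finset κ} (hs : s.Nonempty) (ht : t.Nonempty)
    {T : Finset (ι ×ₗ κ)} (hw : toLex (s.max' hs, t.max' ht) ∉ T) : shuffleCoeff s t T = 0 := by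
  by_contra h
  exact hw (max_mem_of_shuffleCoeff_ne_zero h hs ht)

/-- `m(s ∖ i, t, T) = 0` if `T` contains a vertex in column `i`. [cite: EilenbergMacLane1953, §5] -/
theorem shuffleCoeff_erase_left_eq_zero_of_mem {s : Finset ι} {t : Finset κ} {T : Finset (ι ×ₗ κ)} {i : ι} {w : ι ×ₗ κ}
    (hw : w ∈ T) (hi : (ofLex w).1 = i) : shuffleCoeff (s.erase i) t T = 0 := by
  by_contra h
  have := (mem_of_shuffleCoeff_ne_zero h hw).1
  rw [hi] at this
  exact Finset.notMem_erase i s this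

/-- `m(s, t ∖ j, T) = 0` if `T` contains a vertex in row `j`. [cite: EilenbergMacLane1953, §5] -/
theorem shuffleCoeff_erase_right_eq_zero_of_mem {s : Finset ι} {t : Finset κ} {T : Finset (ι ×ₗ κ)} {j : κ} {w : ι ×ₗ κ}
    (hw : w ∈ T) (hj : (ofLex w).2 = j) : shuffleCoeff s (t.erase j) T = 0 := by
  by_contra h
  have := (mem_of_shuffleCoeff_ne_zero h hw).2
  rw [hj] at this
  exact Finset.notMem_erase j t this

omit [LinearOrder κ] in
/-- The face sign of the maximum: `ε(s, max s) = (-1)^{#s - 1}`. [cite: GortzWedhorn2023, Def. 21.68 (p. 180)] -/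
theorem sign_max' {s : Finset ι} (hs : s.Nonempty) : sign ℤ s (s.max' hs) = (-1) ^ (s.card - 1) := by
  unfold sign
  congr 1
  have h : s.filter (· < s.max' hs) = s.erase (s.max' hs) := by
    ext x
    simp only [Finset.mem_filter, Finset.mem_erase]
    constructor
    · rintro ⟨hx, hlt⟩; exact ⟨hlt.ne, hx⟩
    · rintro ⟨hne, hx⟩; exact ⟨hx, lt_of_le_of_ne (s.le_max' x hx) hne⟩
  rw [h]
  have := Finset.card_erase_add_one (s.max'_mem hs)
  omega

omit [LinearOrder κ] in
/-- Erasing an element NOT below `a` does not change the face sign at `a`. [cite: GortzWedhorn2023, Def. 21.68 (p. 180)] -/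
theorem sign_erase_of_not_lt {s : Finset ι} {x a : ι} (h : ¬ x < a) : sign ℤ (s.erase x) a = sign ℤ s a := by
  unfold sign
  congr 1
  rw [Finset.filter_erase]
  refine congrArg Finset.card (Finset.erase_eq_of_notMem ?_)
  rw [Finset.mem_filter]
  exact fun hx => h hx.2

omit [LinearOrder κ] in
/-- Inserting an element NOT below `a` does not change the face sign at `a`. [cite: GortzWedhorn2023, Def. 21.68 (p. 180)] -/
theorem sign_insert_of_not_lt {s : Finset ι} {x a : ι} (h : ¬ x < a) : sign ℤ (insert x s) a = sign ℤ s a := by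
  unfold sign
  congr 1
  rw [Finset.filter_insert, if_neg h]

omit [LinearOrder κ] in
/-- The face sign of a new top element: `ε(R ∪ {x}, x) = (-1)^{#R}` when `R < x`. [cite: GortzWedhorn2023, Def. 21.68 (p. 180)] -/
theorem sign_insert_self_of_forall_lt {R : Finset ι} {x : ι} (h : ∀ w ∈ R, w < x) : sign ℤ (insert x R) x = (-1) ^ R.card := by
  unfold sign
  congr 1
  rw [Finset.filter_insert, if_neg (lt_irrefl x)]
  refine congrArg Finset.card (Finset.filter_true_of_mem h)

/-- **The empty level**: `Σ_{w ∈ s × t} m(s,t,{w}) · ε({w}, w) = [#s = 1 ∧ #t = 1]` (a one-vertex path exists only in the `1 × 1`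
rectangle). [cite: EilenbergMacLane1953, §5] -/
theorem sum_shuffleCoeff_singleton (s : Finset ι) (t : Finset κ) :
    ∑ w ∈ (s ×ˢ t).image toLex, shuffleCoeff s t {w} * sign ℤ ({w} : Finset (ι ×ₗ κ)) w =
      if s.card = 1 ∧ t.card = 1 then 1 else 0 := by
  have hsign : ∀ w : ι ×ₗ κ, sign ℤ ({w} : Finset (ι ×ₗ κ)) w = 1 := fun w => by
    unfold sign
    rw [Finset.filter_singleton, if_neg (lt_irrefl w), Finset.card_empty, pow_zero]
  simp_rw [hsign, mul_one]
  by_cases h1 : s.card = 1 ∧ t.card = 1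
  · rw [if_pos h1]
    have hs : s.Nonempty := Finset.card_pos.mp (by omega)
    have ht : t.Nonempty := Finset.card_pos.mp (by omega)
    have hw₁ : toLex (s.max' hs, t.max' ht) ∈ (s ×ˢ t).image toLex :=
      mem_image_toLex.mpr ⟨s.max'_mem hs, t.max'_mem ht⟩
    rw [Finset.sum_eq_single_of_mem _ hw₁]
    · rw [shuffleCoeff_of_card_eq_one hs ht h1, if_pos rfl]
    · intro w _ hne
      rw [shuffleCoeff_of_card_eq_one hs ht h1, if_neg]
      intro h
      exact hne (Finset.singleton_injective h)
  · rw [if_neg h1]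
    refine Finset.sum_eq_zero fun w _ => ?_
    by_contra h
    have hc := card_of_shuffleCoeff_ne_zero h
    rw [Finset.card_singleton] at hc
    obtain ⟨hs, ht, -⟩ := shuffleCoeff_ne_zero_imp h
    have := hs.card_pos; have := ht.card_pos
    exact h1 ⟨by omega, by omega⟩

/-- Every point of `s × t` is lexicographically below the last vertex. [cite: StacksProject, Tag 0BEC] -/
theorem le_max_of_mem_image_toLex {s : Finset ι} {t : Finset κ} (hs : s.Nonempty) (ht : t.Nonempty) {w : ι ×ₗ κ}
    (hw : w ∈ (s ×ˢ t).image toLex) : w ≤ toLex (s.max' hs, t.max' ht) := by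
  obtain ⟨h1, h2⟩ := mem_image_toLex.mp hw
  rcases (s.le_max' _ h1).lt_or_eq with hlt | heq
  · exact le_of_lt (Prod.Lex.lt_iff.mpr (Or.inl hlt))
  · exact Prod.Lex.le_iff.mpr (Or.inr ⟨heq, t.le_max' _ h2⟩)


end OrderedCech

end Literature.Algebra.Homology
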